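import Literature.NumberTheory.IwasawaTheory.StickelbergerSeries
import Mathlib.RingTheory.Filtration
import Mathlib.NumberTheory.Multiplicity
import HarnessLib

/-!
# `Λ = ℤ_p⟦T⟧ → lim←ₙ Λ/(h_n)` is SURJECTIVE (`h_n = (1+T)^{pⁿ} − 1`): compatible data modulo every `h_n`
# come from an element of `Λ`; the order of a topological generator of `1 + pℤ_p` modulo `p^{n+1}`;
# the `Λ`-adic Artin element `N − c·σ_N` as a limit of its layers

Literature support for the `𝒞₇` genus road (cell bsd-cm, seat bsd-cm-k-ty1 g23): the EXISTENCE halves of the two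
`Λ`-elements the road's datum pins modulo every `h_j` (`x = N𝔞 − η₁(N𝔞)σ_{N𝔞}` here; the Stickelberger series needs
in addition the distribution relation of its layers, not done here).  THEOREMS ONLY (no definition, no named fact).
Companion of `StickelbergerSeries.lean` §Uniqueness, which proves the INJECTIVE half
(`eq_of_forall_sub_mem_span_layerModulus`, `⋂ₙ (h_n) = 0`).

## Main statements

* `coeff_dvd_of_mem_maximalIdeal_pow`, `mem_maximalIdeal_pow_of_coeff_dvd`: `f ∈ 𝔪_Λ^m ⇔ p^{m−k} ∣ f_k` for all `k`
  (`𝔪_Λ = (p, T)`), Lang Ch. 5 §1.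
* `exists_forall_sub_mem_maximalIdeal_pow`: `Λ` is `𝔪_Λ`-adically (pre)complete — a sequence with
  `g_{n+1} − g_n ∈ 𝔪^{n+1}` has a limit `f` with `f − g_n ∈ 𝔪^n` (coefficientwise `p`-adic completeness of `ℤ_p`).
* `mem_span_singleton_of_forall_mem_sup`: `⋂_N ((a) + 𝔪^N) = (a)` for `a ∈ 𝔪` (Krull in `Λ/(a)`).
* `exists_forall_sub_mem_span_layerModulus`: **Lang Ch. 5 §1 Thm 1.1, surjective half** — if `g_{n+1} ≡ g_n (mod h_n)`
  for all `n` then some `f ∈ Λ` has `f ≡ g_n (mod h_n)` for all `n`.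
* `prime_pow_dvd_of_pow_sub_one_mem_span_pow`: for `p` odd and `u` a topological generator of `1 + pℤ_p`,
  `u^k ≡ 1 (mod p^{n+1}) ⇒ pⁿ ∣ k` (Lang Ch. 10 §1: `γ^{pⁿ}` generates `1 + p^{n+1}ℤ_p`; via lifting-the-exponent).
* `IsLogTable.one_add_X_pow_sub_mem_span_layerModulus`: the layers `(1+T)^{r_j(N)}` of a `γ`-log table are compatible
  modulo `h_j`; `exists_artinElement`: some `x ∈ Λ` has `x ≡ N − c(1+T)^{r_j(N)} (mod h_j)` for every `j`.
* `exists_isStickelbergerSeries_of_layers`: existence of the Stickelberger-branch series REDUCED to the two finite-level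
  congruences of Lang Ch. 10 Thm 1.2 (integrality of `N_n⁻¹L_n` modulo `h_n`, distribution relation `L_{n+1} ≡ pL_n`).

## References
S. Lang, Cyclotomic Fields I and II, GTM 121 (1990), Ch. 5 §1 Thm 1.1 (PDF pp. 115–116), Ch. 10 §1 (PDF pp. 167–168)
[Lang1990]; L. Washington, Introduction to Cyclotomic Fields, Thm 7.1 [folklore companion].
-/

noncomputable section

open PowerSeries

namespace Literature.NumberTheory.IwasawaTheory

open StickelbergerSeries Literature.NumberTheory.EllipticCurves

section MaximalIdeal

variable (p : ℕ) [Fact p.Prime]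

/-- `f ∈ 𝔪_Λ ⇔ p ∣ f(0)` (`Λ` is local with maximal ideal `(p, T)`). [cite: Lang1990, Ch. 5 §1 (PDF p. 115, «Λ is a local ring with maximal ideal (p, X)»)] -/
theorem mem_maximalIdeal_iff_dvd_constantCoeff (f : IwasawaAlgebra p) :
    f ∈ IsLocalRing.maximalIdeal (IwasawaAlgebra p) ↔ (p : ℤ_[p]) ∣ constantCoeff f := by
  rw [IsLocalRing.mem_maximalIdeal, mem_nonunits_iff, PowerSeries.isUnit_iff_constantCoeff,
    ← mem_nonunits_iff, ← IsLocalRing.mem_maximalIdeal, PadicInt.maximalIdeal_eq_span_p, Ideal.mem_span_singleton]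

/-- **`f ∈ 𝔪_Λ^m ⇒ p^{m−k} ∣ f_k` for every `k`** (`𝔪_Λ^m` is spanned by the `p^i T^{m−i}`).
[cite: Lang1990, Ch. 5 §1 (PDF pp. 115–116)] -/
theorem coeff_dvd_of_mem_maximalIdeal_pow {m : ℕ} {f : IwasawaAlgebra p}
    (hf : f ∈ IsLocalRing.maximalIdeal (IwasawaAlgebra p) ^ m) (k : ℕ) :
    (p : ℤ_[p]) ^ (m - k) ∣ coeff k f := by
  induction m generalizing f k with
  | zero => simp
  | succ m ih =>
    rw [pow_succ] at hf
    refine Submodule.mul_induction_on hf ?_ ?_ k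
    · intro a ha b hb k
      rw [coeff_mul]
      refine Finset.dvd_sum fun ij hij => ?_
      have hij' : ij.1 + ij.2 = k := Finset.HasAntidiagonal.mem_antidiagonal.mp hij
      rcases Nat.eq_zero_or_pos ij.2 with h0 | hpos
      · -- `j = 0`: `a_k · b_0` with `p^{m-k} ∣ a_k`, `p ∣ b_0`
        have hi : ij.1 = k := by omega
        have hb0 : (p : ℤ_[p]) ∣ coeff ij.2 b := by
          rw [h0, coeff_zero_eq_constantCoeff]; exact (mem_maximalIdeal_iff_dvd_constantCoeff p b).mp hb
        have h1 : (p : ℤ_[p]) ^ (m + 1 - k) ∣ (p : ℤ_[p]) ^ (m - k) * p := by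
          rw [← pow_succ]; exact pow_dvd_pow _ (by omega)
        exact h1.trans (mul_dvd_mul (hi ▸ ih ha ij.1) hb0)
      · -- `j ≥ 1`: `i ≤ k − 1`, `p^{m-i} ∣ a_i`
        have h1 : (p : ℤ_[p]) ^ (m + 1 - k) ∣ (p : ℤ_[p]) ^ (m - ij.1) := pow_dvd_pow _ (by omega)
        exact h1.trans ((ih ha ij.1).mul_right _)
    · intro x y hx hy k
      rw [map_add]
      exact dvd_add (hx k) (hy k)

/-- **Conversely `p^{m−k} ∣ f_k` for all `k` ⇒ `f ∈ 𝔪_Λ^m`** (`f = f(0) + T·f′`, induction on `m`).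
[cite: Lang1990, Ch. 5 §1 (PDF pp. 115–116)] -/
theorem mem_maximalIdeal_pow_of_coeff_dvd {m : ℕ} :
    ∀ {f : IwasawaAlgebra p}, (∀ k, (p : ℤ_[p]) ^ (m - k) ∣ coeff k f) →
      f ∈ IsLocalRing.maximalIdeal (IwasawaAlgebra p) ^ m := by
  induction m with
  | zero => intro f _; rw [pow_zero, Ideal.one_eq_top]; exact Submodule.mem_top
  | succ m ih =>
    intro f hf
    rw [eq_X_mul_shift_add_const f]
    refine Ideal.add_mem _ ?_ ?_
    · rw [pow_succ']
      refine Ideal.mul_mem_mul (X_mem_maximalIdeal p) (ih fun k => ?_)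
      rw [coeff_mk]
      have := hf (k + 1)
      rwa [Nat.succ_sub_succ] at this
    · obtain ⟨c, hc⟩ := hf 0
      rw [Nat.sub_zero] at hc
      have h1 : C (constantCoeff f) = (C (p : ℤ_[p]) : IwasawaAlgebra p) ^ (m + 1) * C c := by
        rw [← coeff_zero_eq_constantCoeff_apply, hc, map_mul, map_pow]
      rw [h1]
      exact Ideal.mul_mem_right _ _ (Ideal.pow_mem_pow (C_p_mem_maximalIdeal p) _)

/-- **`Λ` is `𝔪_Λ`-adically precomplete**: if `g_{n+1} − g_n ∈ 𝔪^{n+1}` for all `n`, some `f ∈ Λ` has `f − g_n ∈ 𝔪^n`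
for all `n` (each coefficient sequence is `p`-adically Cauchy in the complete ring `ℤ_p`).
[cite: Lang1990, Ch. 5 §1 Thm. 1.1 (PDF pp. 115–116, «the projective limit … is 𝔬[[X]]»)] -/
theorem exists_forall_sub_mem_maximalIdeal_pow (g : ℕ → IwasawaAlgebra p)
    (hg : ∀ n, g (n + 1) - g n ∈ IsLocalRing.maximalIdeal (IwasawaAlgebra p) ^ (n + 1)) :
    ∃ f : IwasawaAlgebra p, ∀ n, f - g n ∈ IsLocalRing.maximalIdeal (IwasawaAlgebra p) ^ n := by
  -- telescoping
  have tel : ∀ n N, n ≤ N → g N - g n ∈ IsLocalRing.maximalIdeal (IwasawaAlgebra p) ^ (n + 1) := by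
    intro n N hnN
    induction N, hnN using Nat.le_induction with
    | base => rw [sub_self]; exact Ideal.zero_mem _
    | succ N hnN ih =>
      have h1 : g (N + 1) - g n = (g (N + 1) - g N) + (g N - g n) := by ring
      rw [h1]
      exact Ideal.add_mem _ (Ideal.pow_le_pow_right (by omega) (hg N)) ih
  -- the coefficient sequences are `p`-adically Cauchy
  have cauchy : ∀ k : ℕ, ∃ L : ℤ_[p], ∀ i : ℕ,
      coeff k (g (i + k)) ≡ L [SMOD (IsLocalRing.maximalIdeal ℤ_[p] ^ i • ⊤ : Submodule ℤ_[p] ℤ_[p])] := by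
    intro k
    refine IsPrecomplete.prec inferInstance fun {i i'} hii' => ?_
    rw [SModEq.sub_mem, Ideal.smul_eq_mul, Ideal.mul_top, PadicInt.maximalIdeal_eq_span_p, Ideal.span_singleton_pow,
      Ideal.mem_span_singleton]
    have h1 := coeff_dvd_of_mem_maximalIdeal_pow p (tel (i + k) (i' + k) (by omega)) k
    rw [show i + k + 1 - k = i + 1 by omega] at h1
    have h2 : coeff k (g (i + k)) - coeff k (g (i' + k)) = -(coeff k (g (i' + k) - g (i + k))) := by
      rw [map_sub]; ring
    rw [h2, dvd_neg]
    exact (pow_dvd_pow _ (Nat.le_succ i)).trans h1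
  choose L hL using cauchy
  refine ⟨PowerSeries.mk L, fun n => mem_maximalIdeal_pow_of_coeff_dvd p fun k => ?_⟩
  rcases Nat.lt_or_ge n k with hk | hk
  · rw [Nat.sub_eq_zero_of_le hk.le, pow_zero]; exact one_dvd _
  · have h1 := hL k (n - k)
    rw [Nat.sub_add_cancel hk, SModEq.sub_mem, Ideal.smul_eq_mul, Ideal.mul_top, PadicInt.maximalIdeal_eq_span_p,
      Ideal.span_singleton_pow, Ideal.mem_span_singleton] at h1
    rw [map_sub, coeff_mk, ← dvd_neg, neg_sub]
    exact h1

/-- **`⋂_N ((a) + 𝔪_Λ^N) = (a)` for `a ∈ 𝔪_Λ`** (Krull's intersection theorem for the finite `Λ`-module `Λ/(a)`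
over the Noetherian local ring `Λ`: the ideal `(a)` is `𝔪`-adically closed).
[cite: Lang1990, Ch. 5 §1 Thm. 1.1 (PDF pp. 115–116)] -/
theorem mem_span_singleton_of_forall_mem_sup {a y : IwasawaAlgebra p}
    (h : ∀ N, y ∈ Ideal.span {a} ⊔ IsLocalRing.maximalIdeal (IwasawaAlgebra p) ^ N) :
    y ∈ Ideal.span {a} := by
  set J : Ideal (IwasawaAlgebra p) := Ideal.span {a}
  have hne : IsLocalRing.maximalIdeal (IwasawaAlgebra p) ≠ ⊤ := (IsLocalRing.maximalIdeal.isMaximal _).ne_top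
  have hx : J.mkQ y ∈ ⨅ i : ℕ, (IsLocalRing.maximalIdeal (IwasawaAlgebra p) ^ i •
      (⊤ : Submodule (IwasawaAlgebra p) (IwasawaAlgebra p ⧸ J))) := by
    refine Submodule.mem_iInf _ |>.mpr fun i => ?_
    obtain ⟨j, hj, m, hm, hjm⟩ := Submodule.mem_sup.mp (h i)
    have h1 : J.mkQ y = J.mkQ m := by
      rw [← hjm, map_add, (Submodule.Quotient.mk_eq_zero J).mpr hj |> fun h => show J.mkQ j = 0 from h, zero_add]
    have hm' : m ∈ IsLocalRing.maximalIdeal (IwasawaAlgebra p) ^ i •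
        (⊤ : Submodule (IwasawaAlgebra p) (IwasawaAlgebra p)) := by
      rw [Ideal.smul_eq_mul, Ideal.mul_top]; exact hm
    rw [h1, ← Submodule.range_mkQ J, ← Submodule.map_top, ← Submodule.map_smul'']
    exact Submodule.mem_map_of_mem hm'
  rw [Ideal.iInf_pow_smul_eq_bot_of_isLocalRing _ hne, Submodule.mem_bot, Submodule.mkQ_apply,
    Submodule.Quotient.mk_eq_zero] at hx
  exact hx

end MaximalIdeal

/-! ## `Λ → lim← Λ/(h_n)` is surjective (Lang Ch. 5 §1 Thm 1.1) -/

section LayerLimit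

variable (p : ℕ) [Fact p.Prime]

/-- `h_n ∣ h_m` for `n ≤ m` (`h_{k+1} = h_k · Σ_{i<p}(h_k + 1)^i`). [cite: Lang1990, Ch. 5 §1 (PDF p. 116, ω_n)] -/
theorem StickelbergerSeries.layerModulus_dvd_layerModulus {n m : ℕ} (h : n ≤ m) :
    layerModulus p n ∣ layerModulus p m := by
  induction m, h using Nat.le_induction with
  | base => exact dvd_rfl
  | succ m _ ih =>
    refine ih.trans ?_
    rw [layerModulus_succ]
    simpa using sub_dvd_pow_sub_pow (layerModulus p m + 1) 1 p

/-- **Lang Ch. 5 §1 Thm 1.1, surjective half: compatible data modulo every `h_n` lift to `Λ`.**  If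
`g_{n+1} ≡ g_n (mod h_n)` for all `n`, there is `f ∈ Λ` with `f ≡ g_n (mod h_n)` for all `n` (`h_n ∈ 𝔪^{n+1}`, so
`(g_n)` is `𝔪`-adically Cauchy; its limit `f` satisfies `f − g_n ∈ ⋂_N ((h_n) + 𝔪^N) = (h_n)`).
[cite: Lang1990, Ch. 5 §1 Thm. 1.1 (PDF pp. 115–116, «Λ ≅ lim 𝔬[X]/(ω_n)»)] -/
theorem StickelbergerSeries.exists_forall_sub_mem_span_layerModulus (g : ℕ → IwasawaAlgebra p)
    (hg : ∀ n, g (n + 1) - g n ∈ Ideal.span {layerModulus p n}) :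
    ∃ f : IwasawaAlgebra p, ∀ n, f - g n ∈ Ideal.span {layerModulus p n} := by
  have hg' : ∀ n, g (n + 1) - g n ∈ IsLocalRing.maximalIdeal (IwasawaAlgebra p) ^ (n + 1) := by
    intro n
    obtain ⟨q, hq⟩ := Ideal.mem_span_singleton'.mp (hg n)
    rw [← hq]
    exact Ideal.mul_mem_left _ _ (layerModulus_mem_maximalIdeal_pow p n)
  obtain ⟨f, hf⟩ := exists_forall_sub_mem_maximalIdeal_pow p g hg'
  -- telescoping modulo `h_n`
  have tel : ∀ n N, n ≤ N → g N - g n ∈ Ideal.span {layerModulus p n} := by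
    intro n N hnN
    induction N, hnN using Nat.le_induction with
    | base => rw [sub_self]; exact Ideal.zero_mem _
    | succ N hnN ih =>
      have h1 : g (N + 1) - g n = (g (N + 1) - g N) + (g N - g n) := by ring
      rw [h1]
      exact Ideal.add_mem _ (Ideal.span_singleton_le_span_singleton.mpr
        (layerModulus_dvd_layerModulus p hnN) (hg N)) ih
  refine ⟨f, fun n => mem_span_singleton_of_forall_mem_sup p fun N => ?_⟩
  have h1 : f - g n = (g (N + n) - g n) + (f - g (N + n)) := by ring
  rw [h1]
  exact Submodule.add_mem_sup (tel n (N + n) (by omega)) (Ideal.pow_le_pow_right (by omega) (hf (N + n)))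

end LayerLimit

/-! ## The order of a topological generator modulo `p^{n+1}` (Lang Ch. 10 §1) -/

section Order

/-- A natural number `m` satisfies `(m : ℤ_p) ∈ (p^N)` iff `p^N ∣ m`. [cite: Lang1990, Ch. 10 §1 (PDF p. 167)] -/
theorem natCast_mem_span_pow_iff (p : ℕ) [Fact p.Prime] (m N : ℕ) :
    ((m : ℕ) : ℤ_[p]) ∈ Ideal.span {(p : ℤ_[p]) ^ N} ↔ p ^ N ∣ m := by
  rw [← PadicInt.ker_toZModPow, RingHom.mem_ker, map_natCast, ZMod.natCast_eq_zero_iff]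

/-- A topological generator of `1 + pℤ_p` is a unit of `ℤ_p`. [cite: Lang1990, Ch. 10 §1 (PDF p. 167)] -/
theorem KubotaLeopoldt.IsTopGenerator.isUnit {p : ℕ} [Fact p.Prime] {u : ℤ_[p]}
    (hu : KubotaLeopoldt.IsTopGenerator p u) : IsUnit u := by
  rw [PadicInt.isUnit_iff]
  have h1 : ‖u - 1‖ < 1 := hu.norm_sub_one_lt_one
  have h2 : ‖(u - 1) + 1‖ = max ‖u - 1‖ ‖(1 : ℤ_[p])‖ :=
    PadicInt.norm_add_eq_max_of_ne (by rw [norm_one]; exact h1.ne)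
  rw [sub_add_cancel, norm_one, max_eq_right h1.le] at h2
  exact h2

/-- **For `p` odd and `u` a topological generator of `1 + pℤ_p`: `u^k ≡ 1 (mod p^{n+1}) ⇒ pⁿ ∣ k`** (the image of
`u` in `(ℤ/p^{n+1})^×` has order `pⁿ`; lifting the exponent `v_p(x^k − 1) = v_p(x − 1) + v_p(k)` for an integer
`x ≡ u` to precision `p^{n+2}`).  [cite: Lang1990, Ch. 10 §1 (PDF p. 167, «γ topological generator»; Thm 1.2, «⟨a⟩ = γ^{α(a)}, r(a) ≡ α(a) mod pⁿ»)] -/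
theorem KubotaLeopoldt.IsTopGenerator.prime_pow_dvd_of_pow_sub_one_mem (p : ℕ) [Fact p.Prime] (hp : p ≠ 2) {u : ℤ_[p]}
    (hu : KubotaLeopoldt.IsTopGenerator p u) {k n : ℕ}
    (h : u ^ k - 1 ∈ Ideal.span {(p : ℤ_[p]) ^ (n + 1)}) : p ^ n ∣ k := by
  have hpr : p.Prime := Fact.out
  have hodd : Odd p := hpr.odd_of_ne_two hp
  have hp1 : (1 : ℝ) < p := by exact_mod_cast hpr.one_lt
  have hnorm : ‖u - 1‖ = (p : ℝ)⁻¹ := hu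
  -- an integer approximation `x` of `u` modulo `p^{n+2}`
  set x : ℕ := PadicInt.appr u (n + 2) with hxdef
  have hux : u - x ∈ Ideal.span {(p : ℤ_[p]) ^ (n + 2)} := PadicInt.appr_spec (n + 2) u
  have hle : ∀ {a b : ℕ}, a ≤ b → Ideal.span {(p : ℤ_[p]) ^ b} ≤ Ideal.span {(p : ℤ_[p]) ^ a} :=
    fun hab => Ideal.span_singleton_le_span_singleton.mpr (pow_dvd_pow _ hab)
  -- `u − 1 ∈ (p)`, `u − 1 ∉ (p²)`
  have hu1 : u - 1 ∈ Ideal.span {(p : ℤ_[p]) ^ 1} := by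
    rw [← PadicInt.norm_le_pow_iff_mem_span_pow, hnorm]
    simp
  have hu2 : u - 1 ∉ Ideal.span {(p : ℤ_[p]) ^ 2} := by
    rw [← PadicInt.norm_le_pow_iff_mem_span_pow, hnorm, not_le]
    have h2 : (p : ℝ) ^ (-(2 : ℕ) : ℤ) < (p : ℝ) ^ (-(1 : ℕ) : ℤ) := zpow_lt_zpow_right₀ hp1 (by norm_num)
    simpa using h2
  -- transfer to `x − 1`
  have hx1 : (x : ℤ_[p]) - 1 ∈ Ideal.span {(p : ℤ_[p]) ^ 1} := by
    have e : (x : ℤ_[p]) - 1 = (u - 1) - (u - x) := by ring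
    rw [e]; exact Ideal.sub_mem _ hu1 (hle (a := 1) (b := n + 2) (by omega) hux)
  have hx2 : (x : ℤ_[p]) - 1 ∉ Ideal.span {(p : ℤ_[p]) ^ 2} := by
    intro hmem
    have e : u - 1 = ((x : ℤ_[p]) - 1) + (u - x) := by ring
    exact hu2 (e ▸ Ideal.add_mem _ hmem (hle (a := 2) (b := n + 2) (by omega) hux))
  have hxpos : 1 ≤ x := by
    rcases Nat.eq_zero_or_pos x with h0 | h0
    · exfalso
      rw [h0, Nat.cast_zero, zero_sub, Ideal.neg_mem_iff] at hx1
      have htop := Ideal.eq_top_of_isUnit_mem _ hx1 isUnit_one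
      rw [Ideal.span_singleton_eq_top, pow_one, PadicInt.isUnit_iff, PadicInt.norm_p] at htop
      exact (inv_lt_one_of_one_lt₀ hp1).ne htop
    · exact h0
  have hpx1 : p ∣ x - 1 := by
    have h1 : ((x - 1 : ℕ) : ℤ_[p]) ∈ Ideal.span {(p : ℤ_[p]) ^ 1} := by
      rw [Nat.cast_sub hxpos, Nat.cast_one]; exact hx1
    simpa using (natCast_mem_span_pow_iff p (x - 1) 1).mp h1
  have hpx2 : ¬ p ^ 2 ∣ x - 1 := by
    intro h2
    apply hx2
    have h1 := (natCast_mem_span_pow_iff p (x - 1) 2).mpr h2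
    rwa [Nat.cast_sub hxpos, Nat.cast_one] at h1
  have hpx : ¬ p ∣ x := by
    intro hd
    have h1 := Nat.dvd_sub hd hpx1
    rw [Nat.sub_sub_self hxpos] at h1
    exact hpr.not_dvd_one h1
  -- transfer the hypothesis to `x^k − 1`
  have hxk : p ^ (n + 1) ∣ x ^ k - 1 := by
    have h1 : (x : ℤ_[p]) ^ k - 1 ∈ Ideal.span {(p : ℤ_[p]) ^ (n + 1)} := by
      have e : (x : ℤ_[p]) ^ k - 1 = (u ^ k - 1) - (u ^ k - (x : ℤ_[p]) ^ k) := by ring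
      rw [e]
      refine Ideal.sub_mem _ h (hle (a := n + 1) (b := n + 2) (by omega) ?_)
      obtain ⟨q, hq⟩ := sub_dvd_pow_sub_pow u (x : ℤ_[p]) k
      rw [hq]; exact Ideal.mul_mem_right _ _ hux
    have h2 : ((x ^ k - 1 : ℕ) : ℤ_[p]) ∈ Ideal.span {(p : ℤ_[p]) ^ (n + 1)} := by
      rw [Nat.cast_sub (Nat.one_le_pow k x hxpos), Nat.cast_pow, Nat.cast_one]; exact h1
    exact (natCast_mem_span_pow_iff p _ _).mp h2
  -- lifting the exponent
  have hmult : emultiplicity p (x - 1) = 1 :=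
    emultiplicity_eq_coe.mpr ⟨by rwa [pow_one], hpx2⟩
  have hlte := Nat.emultiplicity_pow_sub_pow hpr hodd (x := x) (y := 1) (by simpa using hpx1) hpx k
  rw [one_pow, hmult] at hlte
  have H : ((n + 1 : ℕ) : ℕ∞) ≤ 1 + emultiplicity p k := hlte ▸ le_emultiplicity_of_pow_dvd hxk
  apply pow_dvd_of_le_emultiplicity
  by_cases htop : emultiplicity p k = ⊤
  · rw [htop]; exact le_top
  · obtain ⟨m, hm⟩ := ENat.ne_top_iff_exists.mp htop
    rw [← hm] at H ⊢
    have H' : n + 1 ≤ 1 + m := by exact_mod_cast H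
    exact_mod_cast (by omega : n ≤ m)

end Order

/-! ## The layers of a `γ`-log table are compatible; the `Λ`-adic Artin element (Lang Ch. 10 §1–§2) -/

section ArtinElement

/-- `(1+T)^a ≡ (1+T)^b (mod h_j)` when `pʲ ∣ a − b`, `b ≤ a` (`h_j = (1+T)^{pʲ} − 1 ∣ (1+T)^{pʲm} − 1`).
[cite: Lang1990, Ch. 10 §1 Thm 1.2 (PDF p. 168, «h_n = (1+X)^{pⁿ} − 1 … r(a) mod pⁿ»)] -/
theorem StickelbergerSeries.one_add_X_pow_sub_pow_mem_span_layerModulus {p : ℕ} [Fact p.Prime] {j a b : ℕ}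
    (h : p ^ j ∣ a - b) (hba : b ≤ a) :
    ((1 + X : IwasawaAlgebra p) ^ a - (1 + X) ^ b) ∈ Ideal.span {layerModulus p j} := by
  obtain ⟨m, hm⟩ := h
  have e : ((1 + X : IwasawaAlgebra p) ^ a - (1 + X) ^ b) =
      (1 + X) ^ b * (((1 + X : IwasawaAlgebra p) ^ (p ^ j)) ^ m - 1) := by
    rw [← pow_mul, ← hm, mul_sub, mul_one, ← pow_add, Nat.add_sub_cancel' hba]
  rw [e]
  refine Ideal.mul_mem_left _ _ (Ideal.mem_span_singleton.mpr ?_)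
  rw [layerModulus_def]
  simpa using sub_dvd_pow_sub_pow ((1 + X : IwasawaAlgebra p) ^ (p ^ j)) 1 m

/-- **The layers `(1+T)^{r_j(N)}` of a `γ`-log table are compatible modulo `h_j`** (`p` odd, `N` prime to `p`):
`u^{r_{j+1}(N)}ω(N) ≡ N ≡ u^{r_j(N)}ω(N) (mod p^{j+1})` forces `pʲ ∣ r_{j+1}(N) − r_j(N)` (order of `u`), hence
`(1+T)^{r_{j+1}(N)} ≡ (1+T)^{r_j(N)} (mod h_j)` — the image of `σ_N` in `ℤ_p[Γ_j]` does not depend on the level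
at which it is read. [cite: Lang1990, Ch. 10 §1 Thm 1.2 (PDF p. 168, «r(a) … well defined mod pⁿ»)] -/
theorem StickelbergerSeries.IsLogTable.one_add_X_pow_sub_mem_span_layerModulus {p : ℕ} [Fact p.Prime] (hp : p ≠ 2)
    {u : ℤ_[p]} (hu : KubotaLeopoldt.IsTopGenerator p u) {ω : DirichletCharacter ℤ_[p] p} {r : ℕ → ℕ → ℕ}
    (hr : IsLogTable p u ω r) {N : ℕ} (hN : N.Coprime p) (j : ℕ) :
    ((1 + X : IwasawaAlgebra p) ^ (r (j + 1) N) - (1 + X) ^ (r j N)) ∈ Ideal.span {layerModulus p j} := by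
  -- `u^{r_{j+1}} ω(N) ≡ u^{r_j} ω(N) (mod p^{j+1})`
  have h1 : (u ^ (r (j + 1) N) - u ^ (r j N)) * ω (N : ZMod p) ∈ Ideal.span {(p : ℤ_[p]) ^ (j + 1)} := by
    have e : (u ^ (r (j + 1) N) - u ^ (r j N)) * ω (N : ZMod p) =
        (u ^ (r (j + 1) N) * ω (N : ZMod p) - N) - (u ^ (r j N) * ω (N : ZMod p) - N) := by ring
    rw [e]
    refine Ideal.sub_mem _ ?_ (hr j N hN)
    exact Ideal.span_singleton_le_span_singleton.mpr (pow_dvd_pow _ (Nat.le_succ _)) (hr (j + 1) N hN)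
  -- cancel the unit `ω(N)`
  have hωu : IsUnit (ω (N : ZMod p)) := by
    have hNu : IsUnit (N : ZMod p) := by rw [← ZMod.coe_unitOfCoprime N hN]; exact Units.isUnit _
    exact hNu.map ω
  have h2 : u ^ (r (j + 1) N) - u ^ (r j N) ∈ Ideal.span {(p : ℤ_[p]) ^ (j + 1)} :=
    (Ideal.mul_unit_mem_iff_mem _ hωu).mp h1
  have huu : IsUnit u := hu.isUnit
  rcases le_total (r j N) (r (j + 1) N) with hab | hab
  · have h3 : u ^ (r (j + 1) N - r j N) - 1 ∈ Ideal.span {(p : ℤ_[p]) ^ (j + 1)} := by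
      have e : u ^ (r (j + 1) N) - u ^ (r j N) = u ^ (r j N) * (u ^ (r (j + 1) N - r j N) - 1) := by
        rw [mul_sub, mul_one, ← pow_add, Nat.add_sub_cancel' hab]
      rw [e] at h2
      exact (Ideal.unit_mul_mem_iff_mem _ (huu.pow _)).mp h2
    exact one_add_X_pow_sub_pow_mem_span_layerModulus (hu.prime_pow_dvd_of_pow_sub_one_mem p hp h3) hab
  · have h3 : u ^ (r j N - r (j + 1) N) - 1 ∈ Ideal.span {(p : ℤ_[p]) ^ (j + 1)} := by
      have e : u ^ (r (j + 1) N) - u ^ (r j N) = -(u ^ (r (j + 1) N) * (u ^ (r j N - r (j + 1) N) - 1)) := by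
        rw [mul_sub, mul_one, ← pow_add, Nat.add_sub_cancel' hab, neg_sub]
      rw [e, Ideal.neg_mem_iff] at h2
      exact (Ideal.unit_mul_mem_iff_mem _ (huu.pow _)).mp h2
    rw [← Ideal.neg_mem_iff, neg_sub]
    exact one_add_X_pow_sub_pow_mem_span_layerModulus (hu.prime_pow_dvd_of_pow_sub_one_mem p hp h3) hab

/-- **The `Λ`-adic Artin element `N − c·σ_N` exists**: for `p` odd, `u` a topological generator with `γ`-log table
`r` and `N` prime to `p`, some `x ∈ Λ` satisfies `x ≡ N − c(1+T)^{r_j(N)} (mod h_j)` for every `j` (the layers are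
compatible by `IsLogTable.one_add_X_pow_sub_mem_span_layerModulus`, and `Λ → lim← Λ/(h_j)` is onto).
[cite: Lang1990, Ch. 5 §1 Thm. 1.1 (PDF pp. 115–116) with Ch. 10 §1 Thm 1.2 (PDF p. 168)] -/
theorem StickelbergerSeries.IsLogTable.exists_artinElement {p : ℕ} [Fact p.Prime] (hp : p ≠ 2) {u : ℤ_[p]}
    (hu : KubotaLeopoldt.IsTopGenerator p u) {ω : DirichletCharacter ℤ_[p] p} {r : ℕ → ℕ → ℕ}
    (hr : IsLogTable p u ω r) {N : ℕ} (hN : N.Coprime p) (c : ℤ_[p]) :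
    ∃ x : IwasawaAlgebra p, ∀ j : ℕ,
      x - (C (N : ℤ_[p]) - C c * (1 + X) ^ (r j N)) ∈ Ideal.span {layerModulus p j} := by
  refine exists_forall_sub_mem_span_layerModulus p _ fun j => ?_
  have e : (C (N : ℤ_[p]) - C c * (1 + X) ^ (r (j + 1) N)) - (C (N : ℤ_[p]) - C c * (1 + X) ^ (r j N)) =
      -(C c) * ((1 + X : IwasawaAlgebra p) ^ (r (j + 1) N) - (1 + X) ^ (r j N)) := by ring
  rw [e]
  exact Ideal.mul_mem_left _ _ (hr.one_add_X_pow_sub_mem_span_layerModulus hp hu hN j)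

end ArtinElement


/-! ## Existence of the Stickelberger-branch series REDUCED to two finite-level congruences (Lang Ch. 10 Thm 1.2) -/

section StickelbergerExistence

/-- **Existence of the Stickelberger series from its layers' integrality and distribution relation.**  For `d` prime
to `p`: if at every level `n` the layer `L_n = Σ_a ψ(a)·a·(1+T)^{r_n(a)}` is `≡ p^{n+1}·q_n (mod h_n)` for some
`q_n ∈ Λ` (INTEGRALITY of `N_n⁻¹L_n`, `N_n = d·p^{n+1}`) and `L_{n+1} ≡ p·L_n (mod h_n)` (DISTRIBUTION RELATION of
the Bernoulli measure `E_1`), then some `f ∈ Λ` satisfies Lang's congruences `N_n·f ≡ L_n (mod h_n)` at every level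
(`p^{n+2}(q_{n+1} − q_n) ≡ 0`, cancel `p^{n+2}` modulo the primitive `h_n`, lift the compatible `d⁻¹q_n` by
`exists_forall_sub_mem_span_layerModulus`).  The two hypotheses are exactly what Lang's measure-theoretic proof
supplies; they are NOT proved here.
[cite: Lang1990, Ch. 10 §1 Thm 1.2 (PDF pp. 167–168, «f(X) ≡ Σ μ_{n+1}(a)(1+X)^{r(a)} mod h_n») and §2 (2)–(3) (PDF p. 171)] -/
theorem StickelbergerSeries.exists_isStickelbergerSeries_of_layers {p : ℕ} [Fact p.Prime] {d : ℕ} (hd : d.Coprime p)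
    {ψ : DirichletCharacter ℤ_[p] (d * p)} {r : ℕ → ℕ → ℕ}
    (hint : ∀ n : ℕ, ∃ q : IwasawaAlgebra p,
      C ((p : ℤ_[p]) ^ (n + 1)) * q - stickelbergerLayer p d ψ r n ∈ Ideal.span {layerModulus p n})
    (hdist : ∀ n : ℕ, stickelbergerLayer p d ψ r (n + 1) - C (p : ℤ_[p]) * stickelbergerLayer p d ψ r n ∈
      Ideal.span {layerModulus p n}) :
    ∃ f : IwasawaAlgebra p, IsStickelbergerSeries p d ψ r f := by
  choose q hq using hint
  -- `d` is a unit of `ℤ_p`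
  have hdU : IsUnit ((d : ℕ) : ℤ_[p]) := by
    rw [PadicInt.isUnit_iff]
    have h1 : ‖((d : ℤ) : ℤ_[p])‖ ≤ 1 := PadicInt.norm_le_one _
    have h2 : ¬ ‖((d : ℤ) : ℤ_[p])‖ < 1 := by
      rw [PadicInt.norm_int_lt_one_iff_dvd, Int.natCast_dvd_natCast, ← Nat.Prime.coprime_iff_not_dvd Fact.out]
      exact hd.symm
    push_cast at h1 h2
    exact le_antisymm h1 (not_lt.mp h2)
  obtain ⟨du, hdu⟩ := hdU
  -- the compatible system `g_n = d⁻¹ q_n`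
  set g : ℕ → IwasawaAlgebra p := fun n => C ((du⁻¹ : ℤ_[p]ˣ) : ℤ_[p]) * q n with hg
  have hcompat : ∀ n, g (n + 1) - g n ∈ Ideal.span {layerModulus p n} := by
    intro n
    have hsub : Ideal.span {layerModulus p (n + 1)} ≤ Ideal.span {layerModulus p n} :=
      Ideal.span_singleton_le_span_singleton.mpr (layerModulus_dvd_layerModulus p (Nat.le_succ n))
    -- `p^{n+2} (q_{n+1} − q_n) ∈ (h_n)`
    have h1 : C ((p : ℤ_[p]) ^ (n + 2)) * (q (n + 1) - q n) ∈ Ideal.span {layerModulus p n} := by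
      have e : C ((p : ℤ_[p]) ^ (n + 2)) * (q (n + 1) - q n) =
          (C ((p : ℤ_[p]) ^ (n + 1 + 1)) * q (n + 1) - stickelbergerLayer p d ψ r (n + 1)) +
          (stickelbergerLayer p d ψ r (n + 1) - C (p : ℤ_[p]) * stickelbergerLayer p d ψ r n) -
          C (p : ℤ_[p]) * (C ((p : ℤ_[p]) ^ (n + 1)) * q n - stickelbergerLayer p d ψ r n) := by
        simp only [map_pow]; ring
      rw [e]
      exact Ideal.sub_mem _ (Ideal.add_mem _ (hsub (hq (n + 1))) (hdist n)) (Ideal.mul_mem_left _ _ (hq n))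
    have h2 : layerModulus p n ∣ q (n + 1) - q n :=
      layerModulus_dvd_of_dvd_C_pow_mul p n (n + 2) (Ideal.mem_span_singleton.mp h1)
    have e : g (n + 1) - g n = C ((du⁻¹ : ℤ_[p]ˣ) : ℤ_[p]) * (q (n + 1) - q n) := by simp only [hg]; ring
    rw [e]
    exact Ideal.mul_mem_left _ _ (Ideal.mem_span_singleton.mpr h2)
  obtain ⟨f, hf⟩ := exists_forall_sub_mem_span_layerModulus p g hcompat
  refine ⟨f, fun n => ?_⟩
  have e : C ((d * p ^ (n + 1) : ℕ) : ℤ_[p]) * f - stickelbergerLayer p d ψ r n =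
      C ((d * p ^ (n + 1) : ℕ) : ℤ_[p]) * (f - g n) +
        (C ((p : ℤ_[p]) ^ (n + 1)) * q n - stickelbergerLayer p d ψ r n) := by
    have hgn : C ((d * p ^ (n + 1) : ℕ) : ℤ_[p]) * g n = C ((p : ℤ_[p]) ^ (n + 1)) * q n := by
      simp only [hg]
      rw [← mul_assoc, ← map_mul]
      congr 1
      push_cast
      rw [← hdu, mul_comm (du : ℤ_[p]), mul_assoc, Units.mul_inv, mul_one]
    rw [mul_sub, hgn]; ring
  rw [e]
  exact Ideal.add_mem _ (Ideal.mul_mem_left _ _ (hf n)) (hq n)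

end StickelbergerExistence

end Literature.NumberTheory.IwasawaTheory

end
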